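import Mathlib
import Literature.LinearAlgebra.Matrix.StieltjesMatrix
import HarnessLib

/-!
# Proof that Stieltjes matrices are inverse-positive (discharge of `stieltjes_inv_nonneg`)

Topic `LinearAlgebra/Matrix`, namespace `Literature.LinearAlgebra.Matrix`. Discharges the named fact
`Literature.LinearAlgebra.Matrix.stieltjes_inv_nonneg` of `StieltjesMatrix.lean`
(Berman–Plemmons, *Nonnegative Matrices in the Mathematical Sciences*, Ch. 6, Thm. 2.3
[(A₁) ⇒ (N₃₈)] with Def. 2.5 / Exercise 2.6 [BermanPlemmons1994]): a real symmetric positive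
definite Z-matrix has an entrywise nonnegative inverse. This is the one non-Mathlib input of
conclusion (2) of the route support item
`Summit.AtomisticToContinuum.BoseEinsteinCondensation.Theses.BECStoquasticCensoring.StoquasticSchurComplement`
(ledger stmt-AtomisticToContinuum-11480).

## The printed proof and the road taken here

The book derives (N₃₈) from the splitting `A = sI - B`, `B ≥ 0`, `s > ρ(B)` and the Neumann series
`A⁻¹ = s⁻¹ Σ_k (B/s)^k ≥ 0`. For the symmetric (Stieltjes) case we give instead the direct
energy-minimisation argument, which needs no spectral radius:

* `IsZMatrix.dotProduct_abs_mulVec_abs_le` — for a Z-matrix, `|x|ᵀ A |x| ≤ xᵀ A x`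
  (diagonal terms agree, off-diagonal terms `a_ij x_i x_j ≥ a_ij |x_i| |x_j|` since `a_ij ≤ 0`);
* `posDef_isZMatrix_monotone` — a symmetric positive definite Z-matrix is monotone,
  `A x ≥ 0 ⇒ x ≥ 0` (condition (N₃₉)): with `b = A x ≥ 0` and `y = |x|`,
  `(y-x)ᵀA(y-x) = yᵀAy - 2bᵀy + bᵀx ≤ xᵀAx - bᵀx = 0`, so `y = x` by positive definiteness;
* `posDef_isZMatrix_inv_nonneg` — applied to the columns `x = A⁻¹ e_j` (`A x = e_j ≥ 0`) this is
  `A⁻¹ ≥ 0` entrywise, i.e. `stieltjes_inv_nonneg_holds`.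

## References
* A. Berman, R. J. Plemmons, *Nonnegative Matrices in the Mathematical Sciences*, Academic Press
  1979; SIAM Classics in Applied Mathematics 9, 1994 (same numbering), Ch. 6: Def. 2.5,
  Exercise 2.6, Thm. 2.3 (N₃₈), (N₃₉) [BermanPlemmons1994]; locators checked in the held 1979
  edition (`book:berman1979-nonnegative-matrices-mathematical-sciences`, chunks p0104–p0105, p0109).
-/

namespace Literature.LinearAlgebra.Matrix

open scoped _root_.Matrix
open Finset _root_.Matrix

variable {n : Type*} [Fintype n] [DecidableEq n]

/-- For a Z-matrix `A` (off-diagonal entries `≤ 0`), passing to absolute values does not increase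
the quadratic form: `|x|ᵀ A |x| ≤ xᵀ A x`. [cite: BermanPlemmons1994, Ch. 6, Exercise 2.6] -/
theorem IsZMatrix.dotProduct_abs_mulVec_abs_le {A : Matrix n n ℝ} (hZ : IsZMatrix A)
    (x : n → ℝ) :
    (fun i => |x i|) ⬝ᵥ (A *ᵥ fun i => |x i|) ≤ x ⬝ᵥ (A *ᵥ x) := by
  simp only [dotProduct, mulVec, Finset.mul_sum]
  refine Finset.sum_le_sum fun i _ => ?_
  refine Finset.sum_le_sum fun j _ => ?_
  have e1 : |x i| * (A i j * |x j|) = A i j * (|x i| * |x j|) := by ring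
  have e2 : x i * (A i j * x j) = A i j * (x i * x j) := by ring
  rw [e1, e2]
  by_cases hij : i = j
  · subst hij
    rw [abs_mul_abs_self]
  · exact mul_le_mul_of_nonpos_left (by rw [← abs_mul]; exact le_abs_self _) (hZ i j hij)

/-- **Symmetric positive definite Z-matrices are monotone** (`A x ≥ 0 ⇒ x ≥ 0`,
Berman–Plemmons Thm. 6.2.3 (N₃₉) for Stieltjes matrices, Exercise 6.2.6).
[cite: BermanPlemmons1994, Ch. 6, Thm. 2.3 (N₃₉) and Exercise 2.6] -/
theorem posDef_isZMatrix_monotone {A : Matrix n n ℝ} (hA : A.PosDef) (hZ : IsZMatrix A)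
    (x : n → ℝ) (hb : ∀ k, 0 ≤ (A *ᵥ x) k) : ∀ k, 0 ≤ x k := by
  set b : n → ℝ := A *ᵥ x with hb_def
  set y : n → ℝ := fun k => |x k| with hy_def
  have hAT : Aᵀ = A := by
    have h := hA.1
    rw [IsHermitian, conjTranspose_eq_transpose_of_trivial] at h
    exact h
  -- `vᵀ A w` is symmetric
  have hsym : ∀ v w : n → ℝ, v ⬝ᵥ (A *ᵥ w) = w ⬝ᵥ (A *ᵥ v) := by
    intro v w
    rw [dotProduct_mulVec, ← mulVec_transpose, hAT, dotProduct_comm]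
  have h1 : y ⬝ᵥ (A *ᵥ y) ≤ x ⬝ᵥ (A *ᵥ x) := hZ.dotProduct_abs_mulVec_abs_le x
  have h2 : x ⬝ᵥ b ≤ y ⬝ᵥ b :=
    Finset.sum_le_sum fun k _ => mul_le_mul_of_nonneg_right (le_abs_self _) (hb k)
  have hxAy : x ⬝ᵥ (A *ᵥ y) = y ⬝ᵥ b := hsym x y
  have hquad : (y - x) ⬝ᵥ (A *ᵥ (y - x)) ≤ 0 := by
    have : (y - x) ⬝ᵥ (A *ᵥ (y - x)) =
        y ⬝ᵥ (A *ᵥ y) - y ⬝ᵥ b - (y ⬝ᵥ b) + x ⬝ᵥ b := by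
      rw [mulVec_sub, sub_dotProduct, dotProduct_sub, dotProduct_sub, hxAy]
      ring
    rw [this]
    linarith
  -- positive definiteness forces `y = x`
  have hyx : y - x = 0 := by
    by_contra hne
    have hpos := hA.dotProduct_mulVec_pos hne
    simp only [star_trivial] at hpos
    linarith
  intro k
  have hk : |x k| - x k = 0 := by
    have := congrFun hyx k
    simpa [hy_def] using this
  linarith [abs_nonneg (x k)]

/-- **Stieltjes matrices are inverse-positive.** A real symmetric positive definite Z-matrix
(a Stieltjes matrix: "A symmetric matrix `A ∈ Z^{n×n}` is a Stieltjes matrix if and only if `A` is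
positive definite", Exercise 6.2.6) satisfies condition (N₃₈) of Thm. 6.2.3: "`A⁻¹` exists and
`A⁻¹ ≥ 0`". [cite: BermanPlemmons1994, Ch. 6, Def. 2.5, Exercise 2.6, Thm. 2.3 (N₃₈)] -/
theorem posDef_isZMatrix_inv_nonneg {A : Matrix n n ℝ} (hA : A.PosDef) (hZ : IsZMatrix A)
    (i j : n) : 0 ≤ A⁻¹ i j := by
  have hdet : IsUnit A.det := (isUnit_iff_isUnit_det A).mp hA.isUnit
  set x : n → ℝ := A⁻¹ *ᵥ Pi.single j 1 with hx_def
  have hAx : A *ᵥ x = Pi.single j 1 := by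
    rw [hx_def, mulVec_mulVec, mul_nonsing_inv _ hdet, one_mulVec]
  have hb : ∀ k, 0 ≤ (A *ᵥ x) k := by
    intro k
    rw [hAx]
    by_cases hk : k = j
    · subst hk; simp
    · simp [hk]
  have hx := posDef_isZMatrix_monotone hA hZ x hb i
  have : x i = A⁻¹ i j := by
    rw [hx_def, mulVec_single_one]
    rfl
  rw [← this]
  exact hx

/-- **Discharge of the named fact `stieltjes_inv_nonneg`** (Berman–Plemmons Ch. 6, Thm. 2.3
[(A₁) ⇒ (N₃₈)] with Def. 2.5 / Ex. 2.6): Stieltjes matrices are inverse-positive.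
[cite: BermanPlemmons1994, Ch. 6, Thm. 2.3 (A₁)⇔(N₃₈) and Ex. 2.6] -/
theorem stieltjes_inv_nonneg_holds : stieltjes_inv_nonneg := by
  intro n _ _ A hA hZ i j
  exact posDef_isZMatrix_inv_nonneg hA hZ i j

end Literature.LinearAlgebra.Matrix
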